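import Summits.ValiantsHypothesis.ValiantsHypothesis.Theorems.ToricFixedPoints.Negative.FormDeborderingContentClasses33

/-!
# `ToricFixedPoints` / line `form_then_lift`, stub F1 at `(3,3)`: the sixth content class — the
permutation-monomial family `F_c = Σ_σ c_σ ∏ᵢ x_{σ(i),i}` on the torus-orbit hypersurface is End-type

Disproof.lean §6d: `GL₉·det₃ ∩ {F_c} = {c ∈ (ℂ*)⁶ : c_id c_(123) c_(132) + c_(12) c_(13) c_(23) = 0}`
(torus rescalings).  This file puts the constructive half in the kernel: if
`c_id c_A c_B + c₀₁ c₀₂ c₁₂ = 0` (`A, B` the two 3-cycles, `c₀₁, c₀₂, c₁₂` the transpositions) and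
`c_id, c₀₁, c₀₂ ≠ 0`, then `F_c = diag(t)·det₃` for the explicit rescaling
`t = (1, 1, 1; -c₀₁/c_id, 1, -c_B/c₀₂; -c₀₂, -c_A c_id/c₀₁, c_id)` (row-major), in particular
`F_c ∈ End(ℂ⁹)·det₃` and (by `FormDeborderingEndType`) `F_c` has F1's toric shape.  Zero patterns of
`c` compatible with the relation are reached by the same formula whenever `c_id c₀₁ c₀₂ ≠ 0` (entries of
`t` may vanish); the remaining patterns follow by the `S₃ × S₃ ⋊ ℤ/2` symmetry on paper.  What is NOT
covered — and is the whole content of F1 at (3,3) — is the converse "`F_c ∈ Δ(det₃)` only if the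
relation holds", an LMR-type non-membership statement (`G₃ = F_{(1,1,1,0,0,0)}`: relation value `1`).
Refuter/theory seat `val-width-5779-d1` (stmt-ValiantsHypothesis-5779).  VP ≠ VNP is not touched.
-/

open MvPolynomial Finset
open Literature.Computability.AlgebraicComplexity

namespace Summit.ValiantsHypothesis.Cruxes.ToricFixedPoints.Negative

/-- **The permutation-monomial family on the torus hypersurface is End-type.**  With
`F_c = c_id x₀₀x₁₁x₂₂ + c_A x₁₀x₂₁x₀₂ + c_B x₂₀x₀₁x₁₂ + c₀₁ x₁₀x₀₁x₂₂ + c₀₂ x₂₀x₁₁x₀₂ + c₁₂ x₀₀x₂₁x₁₂`: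
if `c_id c_A c_B + c₀₁ c₀₂ c₁₂ = 0` and `c_id c₀₁ c₀₂ ≠ 0` then `F_c ∈ End(ℂ⁹)·det₃` (explicit diagonal
rescaling). [folklore] -/
theorem permFamily_mem_endOrbit (cId cA cB c₀₁ c₀₂ c₁₂ : ℂ) (hId : cId ≠ 0) (h₀₁ : c₀₁ ≠ 0)
    (h₀₂ : c₀₂ ≠ 0) (hrel : cId * cA * cB + c₀₁ * c₀₂ * c₁₂ = 0) :
    (C cId * (X (0, 0) * X (1, 1) * X (2, 2)) + C cA * (X (1, 0) * X (2, 1) * X (0, 2)) +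
        C cB * (X (2, 0) * X (0, 1) * X (1, 2)) + C c₀₁ * (X (1, 0) * X (0, 1) * X (2, 2)) +
        C c₀₂ * (X (2, 0) * X (1, 1) * X (0, 2)) + C c₁₂ * (X (0, 0) * X (2, 1) * X (1, 2)) :
        MvPolynomial (Fin 3 × Fin 3) ℂ) ∈ endOrbit (Fin 3 × Fin 3) ℂ (detPoly (Fin 3) ℂ) := by
  have h := det_smul_X_mem_endOrbit (K := ℂ)
    ![![(1 : ℂ), 1, 1], ![-c₀₁ / cId, 1, -cB / c₀₂], ![-c₀₂, -cA * cId / c₀₁, cId]]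
    ![![((0 : Fin 3), (0 : Fin 3)), (0, 1), (0, 2)], ![(1, 0), (1, 1), (1, 2)],
      ![(2, 0), (2, 1), (2, 2)]]
  convert h using 1
  rw [Matrix.det_fin_three]
  simp only [Matrix.of_apply, Matrix.cons_val_zero, Matrix.cons_val_one, Matrix.cons_val,
    smul_eq_C_mul, map_one, one_mul]
  -- the six scalar products
  have e₀₁ : (C (-c₀₁ / cId) * C cId : MvPolynomial (Fin 3 × Fin 3) ℂ) = -C c₀₁ := by
    rw [← map_mul, ← map_neg]; congr 1; field_simp
  have eB : (C (-cB / c₀₂) * C (-c₀₂) : MvPolynomial (Fin 3 × Fin 3) ℂ) = C cB := by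
    rw [← map_mul]; congr 1; field_simp
  have eA : (C (-c₀₁ / cId) * C (-cA * cId / c₀₁) : MvPolynomial (Fin 3 × Fin 3) ℂ) = C cA := by
    rw [← map_mul]; congr 1; field_simp
  have e₁₂ : (C (-cA * cId / c₀₁) * C (-cB / c₀₂) : MvPolynomial (Fin 3 × Fin 3) ℂ) = -C c₁₂ := by
    rw [← map_mul, ← map_neg]; congr 1; field_simp; linear_combination hrel
  have e₀₂ : (C (-c₀₂) : MvPolynomial (Fin 3 × Fin 3) ℂ) = -C c₀₂ := map_neg _ _
  linear_combination (X (1, 0) * X (0, 1) * X (2, 2) : MvPolynomial (Fin 3 × Fin 3) ℂ) * e₀₁ -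
    (X (2, 0) * X (0, 1) * X (1, 2)) * eB - (X (1, 0) * X (2, 1) * X (0, 2)) * eA +
    (X (0, 0) * X (2, 1) * X (1, 2)) * e₁₂ + (X (2, 0) * X (1, 1) * X (0, 2)) * e₀₂

end Summit.ValiantsHypothesis.Cruxes.ToricFixedPoints.Negative
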